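import Literature.MathematicalPhysics.QuantumFieldTheory.Balaban1983to89.B9WalkLettersOps
import Literature.MathematicalPhysics.QuantumFieldTheory.Balaban1983to89.B9WalkLettersKernelsDom
import Literature.MathematicalPhysics.QuantumFieldTheory.Balaban1983to89.B9WalkLettersKernelsRows

/-!
# `Balaban1983to89.B9WalkLettersOpsFacts` — W-a FILE C-2 (part 3, proofs): THE N06 CERTIFICATE'S rows-18 BINDERS `hst ∕ hκ` AND `h36`'s `Identities₂` CONJUNCT
# DISCHARGED AT THE WALK LETTERS OF RECORD (`B9WalkLettersOps.opsWalkY`) — static data, sizes `O(M⁻¹)`, and the algebraic structure of the expansion (3.87)–(3.88)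

statement-level skeleton of published theorems with citation tags; proofs where landed; nothing here is a claim about the Yang–Mills mass gap

B9 = T. Bałaban, *Propagators for lattice gauge theories in a background field*, Commun. Math. Phys. **99** (1985) 389–434 [Balaban1985BackgroundPropagators];
[4] = T. Bałaban, *Propagators and renormalization transformations for lattice gauge theories. II*, Commun. Math. Phys. **96** (1984) 223–250 [Balaban1984PropagatorsII].
THE PRINT.  (3.87) p.409 `G′₀ = Σ_□ h_□G′_□h_□` («Σ h_□² = 1», «the cubes □̃ overlap finitely often»); (3.88) «Δ′_aG′₀ = I − Σ_□K(h_□)G′_□h_□», `K(h_□) = Σ_μ P_□,μ∇_{U,μ} + C_□`;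
(3.89) «K(h_□) … of size O(M⁻¹)»; (3.100) p.413 (Leibniz rules through `M_h`); (3.27) p.395 (`G′ = Δ′_a⁻¹` restricted); [4] (2.36)–(2.44) pp.229–230, (2.46) p.231,
(2.51) p.232, (2.54) p.233, Lemma 2.1 (2.61) p.234.
WHY THIS FILE (pub-ymgap, dag-n06-d W-a C-2 programme, HOME `W-a-C2-PLAN.md`).  The N06 certificate (edition 46) displays for the rows-18 walk letters: `hst : ∀ x, StaticOK (𝔬 x) ρ
N_c N′ C_ℓ (κ x)` (45 clauses), `hκ : ∀ x, (κ x).Bounded K_c θ₀ C_ℓ (geo9Y x).M`, and in the schema `h36` the conjunct `Identities₂ (𝔬 x) (𝔡 x) (𝔩 x) 1 (H x) U` (21 clauses).  At the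
record `𝔬 := opsWalkY x b B cfg parS bI`, `𝔡 := dirOpsWalkY …`, `𝔩 := dirLettersWalkY …`, `κ := kappaWalkY x b` every clause is a landed fact of parts C-1 ∕ 1 ∕ 2a ∕ 2b:
* §1 `len_le_Lsq_mul_len_of_mem_SblkY` (`StaticOK.comp` with `C_ℓ = L²`, from part 2b-I's level window), `ite_congr_dec` (the certificate's `DecidableEq (geo9Y x).Site` is a
  variable, the landed lemmas carry the concrete instance);
* §2 ★★★ `staticOK_opsWalkY`: `StaticOK (opsWalkY …) ρ N_c N′ C_ℓ (kappaWalkY x b)` for every `ρ ≥ 3`, `N_c, N′ ≥ walkCntY`, `C_ℓ ≥ L²`, under the pins `hβ1 ∕ hlev` and the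
  thresholds `walkCntM₀Y ≤ M`, `nbrM₀Y 3 ≤ M⋆` (geometry `B9GeoLemma21KLevelV1`; `hh ∕ hS ∕ cnt` C-1; the 27 kernel clauses `B9WalkLettersKernelsRows`);
* §3 ★★ `bounded_kappaWalkY`: `(kappaWalkY x b).Bounded K_c θ₀ C_ℓ (geo9Y x).M` for `K_c ≥ KcWalkY`, `θ₀ ≥ thetaWalkY C_ℓ`, `C_ℓ ≥ 0` (`M = L·M_h`, `M_h ≥ 2`: print's «for
  M sufficiently large» as two explicit member-uniform constants);
* §4 `mulOp_hWalkY_eq_mulcoS` (the certificate's real cut-off `mulOp (hWalkY x c)` IS the model `mulcoS b (hTY c)`, any basis) and ★★★ `identities₂_opsWalkY`: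
  `Identities₂ (opsWalkY …) (dirOpsWalkY …) (dirLettersWalkY …) R H U` for contraction-pair transporters (DISPLAYED: print's `U(b) ∈ G ⊂ U(N)`), under `c_R ≠ 0` and the
  units `IsUnit (Δ′_a(U))`, `IsUnit (padDeltaY … □̃(c) U)` of (3.27) (regime facts, DISPLAYED) — the eight dominations of `B9WalkLettersKernelsDom`, the Leibniz ∕ inverse ∕
  (3.88) clauses of `B9WalkLettersCoordsLeib`, `Σ_□ h_□² = 1` and `supp h_□ ⊂ □̃` of r03 ∕ C-1.
`LocalityDir` and the walk reading's `OKRel` (def-Y ruling on WORD-W1, l.42897: option (A)) follow; then the rows-18 edition of the certificate.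
HONEST SCOPE.  Assembly of landed clauses + arithmetic; transporter contraction, the unit families, `c_R ≠ 0`, the pins and thresholds stay DISPLAYED; nothing of [B9]'s
analysis asserted; no (3.42); count-neutral; N06 NOT discharged; nothing continuum ∕ OS ∕ mass gap ∕ Clay.  Cell `pub-ymgap` (D-0062), node N06 [B9], rows 18, seat
`pub-ymgap-dag-n06-d` (gen 14).  Net new unproved facts: 0.  NEW file.
-/

noncomputable section

namespace Literature.MathematicalPhysics.QuantumFieldTheory.Balaban1983to89.B9WalkLettersOpsFacts

open Node00
open B6KLevelCensusIndexV1 (KIdx)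
open B6Ineq2142KLevelV1 (β lvl)
open B6MultiLevelBoxOperator (bigSide bigSide_eq)
open B6Cover236MultiLevelBlocks (cubes)
open B6Partition118KLevelFineSizes (C1F C1F_nonneg)
open B6Partition118KLevelFineSecond (C2F C2F_nonneg)
open B6Partition118KLevelTorusBinders (sLipT sLipT_nonneg)
open B9Thm37Whole (Ops Sizes StaticOK)
open B9Thm37CubeCoverCommutatorSizes (side_conditions)
open B9Thm39ReadingCoords (cR39 cR39_nonneg)
open B9Ineq349SiteComposite (etaS_pos)
open B9Ineq349SiteFromBlocks (geo9Y_M_eq)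
open B9PinMembersKLevelV1 (MemberY geo9Y)
open B9GeoLemma21KLevelV1 (geo9K_dist_nonneg' geo9Y_dist_comm geo9Y_dist_self geo9Y_dist_triangle geo9Y_len_pos)
open B9GeoNbrCountKLevelV1 (nbrM₀Y nbrCountY)
open B9CoReadingCoordsS (XSK blkSK sIK)
open B9WalkLettersCoordsS (SblkY hWalkY walkCntM₀Y walkCntY walkCntY_nonneg abs_hWalkY_le_one blkSK_mem_SblkY_of_hWalkY_ne_zero sum_indicator_SblkY_le)
open B9WalkLettersKernels
open B9WalkLettersKernelsStatic (len_window_of_mem_SblkY)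
open B9WalkLettersKernelsRows
open B9WalkLettersOps
open B6RandomWalk (HasMajorant)
open B6RandomWalkHom (HasMajorantHom hasMajorantHom_iff hasMajorantHom_zero)
open B6Partition118KLevelTorus (sum_hT_sq)
open B9Thm34Ext (toB6)
open B9Thm37Sum (mulOp)
open B9Thm37Whole (Ops)
open B9Thm37WholeDir (Identities₂)
open B9Thm37CubeCoverCommutators (cutMulY cutMulY_apply hTY one_le_Mh_and_P)
open B9Thm39ReadingCoords (cR39)
open B9CoReadingCoords (coordOpK coordOpK_apply)
open B9CoReadingCoordsS (XSK blkSK sIK GcoS)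
open Node00.OpsYSectDCoords (repr_assembleK)
open Node00.OpsYLocalInverse (padDeltaY)
open B9WalkLettersCoordsS (cubeDomY hWalkY mem_cubeDomY_of_hTY_ne_zero)
open B9WalkLettersCoordsLeib (mulcoS leibD_coords leibT_coords leibL_coords inv_coords eq388_coords eq388T_coords)
open B9WalkLettersKernelsDom
open B9WalkLettersKernelsRows (kernels_nonneg)

variable {d ℓ : ℕ} {hd : 1 ≤ d + 1} {hL : Odd (ℓ + 1) ∧ 1 < ℓ + 1} {b₀ b₁ : ℝ} {Mstar : ℕ}
variable {𝔸 : Type} [NormedRing 𝔸] [NormedAlgebra ℂ 𝔸] [CompleteSpace 𝔸] [FiniteDimensional ℝ 𝔸] {κ : Type} [Fintype κ] [DecidableEq κ]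
variable (x : MemberY d ℓ hd hL b₀ b₁ Mstar) (b : Module.Basis κ ℝ 𝔸) (B : B9.Backgrounds) (cfg : B.Cfg → CfgY 𝔸 x.toKIdx) (parS : SiteParY 𝔸 x.toKIdx)
variable (bI : FBondY x.toKIdx → IBondY x.toKIdx) [Fintype (geo9Y x).Site] [DecidableEq (geo9Y x).Site]

/-! ## §1 The scale comparability on `S_□ × S_□` -/

omit [NormedAlgebra ℂ 𝔸] [CompleteSpace 𝔸] [FiniteDimensional ℝ 𝔸] [Fintype κ] [DecidableEq κ] [Fintype (geo9Y x).Site] [DecidableEq (geo9Y x).Site] in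
/-- ★ **`StaticOK.comp` AT THE RECORD with `C_ℓ = L²`**: two blocks of `S_□(c)` have scale lengths comparable by `L²` (both lie in the level window `[j − 1, j + 1]` of `□̃(c)`).
[cite: Balaban1984PropagatorsII, (2.36) p.229, p.235 («□̃»), (2.1)–(2.2) p.224; Balaban1985BackgroundPropagators, p.409] -/
theorem len_le_Lsq_mul_len_of_mem_SblkY (hlev : ∀ f : FBondY x.toKIdx, lvl x.hN x.D x.hk (bI f) = (B6GlobalChartV1.blkV1 x.hN x.D f).1.1)
    (c : ↥(cubes x.toKIdx.D.toDomains)) {a a' : IBondY x.toKIdx} (ha : a ∈ SblkY x bI c) (ha' : a' ∈ SblkY x bI c) :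
    (geo9Y x).len a ≤ (((ℓ + 1 : ℕ) : ℝ)) ^ 2 * (geo9Y x).len a' := by
  obtain ⟨_, hMh, _, _⟩ := side_conditions x.toKIdx
  have hM : (0 : ℝ) < x.toKIdx.Mh := by exact_mod_cast lt_of_lt_of_le (by norm_num) hMh
  have h1 := (len_window_of_mem_SblkY x bI hlev c ha).1     -- `M_h·ℓ(a) ≤ S_j·η`
  have h2 := (len_window_of_mem_SblkY x bI hlev c ha').2    -- `L^j·η ≤ L·ℓ(a′)`
  rw [bigSide_eq] at h1
  push_cast at h1
  have hL0 : (0 : ℝ) ≤ ((ℓ : ℝ) + 1) := by positivity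
  -- `ℓ(a) ≤ L·(L^j η) ≤ L·(L·ℓ(a′))`
  have h3 : (geo9Y x).len a ≤ ((ℓ : ℝ) + 1) * (((ℓ : ℝ) + 1) ^ c.1.1 * etaS x.toKIdx) := by
    have : (x.toKIdx.Mh : ℝ) * (geo9Y x).len a ≤ (x.toKIdx.Mh : ℝ) * (((ℓ : ℝ) + 1) * (((ℓ : ℝ) + 1) ^ c.1.1 * etaS x.toKIdx)) := by
      calc (x.toKIdx.Mh : ℝ) * (geo9Y x).len a ≤ ((ℓ : ℝ) + 1) ^ c.1.1 * ((x.toKIdx.Mh : ℝ) * ((ℓ : ℝ) + 1)) * etaS x.toKIdx := h1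
        _ = (x.toKIdx.Mh : ℝ) * (((ℓ : ℝ) + 1) * (((ℓ : ℝ) + 1) ^ c.1.1 * etaS x.toKIdx)) := by ring
    exact le_of_mul_le_mul_left this hM
  calc (geo9Y x).len a ≤ ((ℓ : ℝ) + 1) * (((ℓ : ℝ) + 1) ^ c.1.1 * etaS x.toKIdx) := h3
    _ ≤ ((ℓ : ℝ) + 1) * (((ℓ : ℝ) + 1) * (geo9Y x).len a') := mul_le_mul_of_nonneg_left h2 hL0
    _ = (((ℓ + 1 : ℕ) : ℝ)) ^ 2 * (geo9Y x).len a' := by push_cast; ring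

/-- an `if` does not depend on the decision instance (the certificate's `DecidableEq (geo9Y x).Site` is a variable, the landed lemmas carry the concrete one).
[cite: Balaban1984PropagatorsII, (2.44) p.230, bookkeeping] -/
theorem ite_congr_dec {P : Prop} {i₁ i₂ : Decidable P} {t e : ℝ} : @ite ℝ P i₁ t e = @ite ℝ P i₂ t e := by congr

/-! ## §2 `StaticOK` at the record -/

omit [DecidableEq κ] in
/-- ★★★ **`hst` AT THE RECORD**: `StaticOK (opsWalkY x b B cfg parS bI) ρ N_c N′ C_ℓ (kappaWalkY x b)` for every radius `ρ ≥ 3`, counts `N_c, N′ ≥ walkCntY`, comparability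
`C_ℓ ≥ L²`, under the pins `hβ1 ∕ hlev` and the thresholds `walkCntM₀Y ≤ (geo9Y x).M`, `nbrM₀Y … 3 ≤ M⋆`.
[cite: Balaban1985BackgroundPropagators, (3.87)–(3.89) pp.408–409; Balaban1984PropagatorsII, (2.36)–(2.44) pp.229–230, (2.46) p.231, (2.54) p.233, Lemma 2.1 (2.61) p.234] -/
theorem staticOK_opsWalkY
    (hβ1 : ∀ f : FBondY x.toKIdx, (B6Geom246MultiLevelTorus.geomT x.D).dist (β x.hN x.D x.hk (bI f)) (B6GlobalChartV1.blkV1 x.hN x.D f) ≤ 1)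
    (hlev : ∀ f : FBondY x.toKIdx, lvl x.hN x.D x.hk (bI f) = (B6GlobalChartV1.blkV1 x.hN x.D f).1.1)
    (hMw : walkCntM₀Y d ℓ hd hL b₀ b₁ Mstar ≤ (geo9Y x).M) (hM3 : nbrM₀Y d ℓ hd hL b₀ b₁ 3 ≤ Mstar)
    {ρ Nc N' Cℓ : ℝ} (hρ : 3 ≤ ρ) (hNc : walkCntY d ℓ hd hL b₀ b₁ Mstar ≤ Nc) (hN' : walkCntY d ℓ hd hL b₀ b₁ Mstar ≤ N') (hCℓ : (((ℓ + 1 : ℕ) : ℝ)) ^ 2 ≤ Cℓ) :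
    StaticOK (opsWalkY x b B cfg parS bI) ρ Nc N' Cℓ (kappaWalkY x b) := by
  have hnn := fun c μ a y'' => kernels_nonneg x b bI c μ a y''
  have hrl := fun c a y'' => kernels_row_loc x b bI c a y''
  have hcl := fun c y'' a => kernels_col_loc x b bI c y'' a
  refine
    { tri := geo9Y_dist_triangle x
      refl := geo9Y_dist_self x
      symm := geo9Y_dist_comm x
      dnn := geo9K_dist_nonneg' x.toKIdx
      lenpos := geo9Y_len_pos x
      hh := fun c p => abs_hWalkY_le_one x c p
      hS := fun c p hp => blkSK_mem_SblkY_of_hWalkY_ne_zero x bI c hp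
      hhY := fun c p => abs_hWalkY_le_one x c p
      hSY := fun c p hp => blkSK_mem_SblkY_of_hWalkY_ne_zero x bI c hp
      cnt := fun a => le_trans (le_of_eq (Finset.sum_congr rfl fun c _ => ite_congr_dec)) ((sum_indicator_SblkY_le x bI hβ1 hMw a).trans hNc)
      cnt' := fun a => le_trans (le_of_eq (Finset.sum_congr rfl fun c _ => ite_congr_dec)) ((sum_indicator_SblkY_le x bI hβ1 hMw a).trans hN')
      comp := fun c a a' ha ha' => (len_le_Lsq_mul_len_of_mem_SblkY x bI hlev c ha ha').trans
        (mul_le_mul_of_nonneg_right hCℓ (geo9Y_len_pos x a').le)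
      KP_nonneg := fun c a y'' => (hnn c 0 a y'').2.1
      KP_loc := fun c a y'' h => ((hrl c a y'').1 h).trans hρ
      KP_row := fun c a => (kPY_row x b bI hlev hM3 c a).trans (le_of_eq ite_congr_dec)
      KC_nonneg := fun c a y'' => (hnn c 0 a y'').2.2.2.2.2.2.1
      KC_loc := fun c a y'' h => ((hrl c a y'').2.1 h).trans hρ
      KC_row := fun c a => (kCY_row x b bI hlev hM3 c a).trans (le_of_eq ite_congr_dec)
      KPD_nonneg := fun c a y'' => (hnn c 0 a y'').2.2.2.2.2.2.2.2.2.2.2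
      KPD_loc := fun c a y'' h => ((hrl c a y'').2.2.1 h).trans hρ
      KPD_row := fun c a => (kPDY_row x bI hlev hM3 c a).trans (le_of_eq ite_congr_dec)
      KCD_nonneg := fun c a y'' => (hnn c 0 a y'').2.2.2.2.2.2.2.2.2.1
      KCD_loc := fun c a y'' h => ((hrl c a y'').2.2.2.1 h).trans hρ
      KCD_row := fun c a => (kCDY_row x b bI hlev hM3 c a).trans (le_of_eq ite_congr_dec)
      KPL_nonneg := fun c a y'' => (hnn c 0 a y'').2.2.2.2.2.1
      KPL_loc := fun c a y'' h => ((hrl c a y'').2.2.2.2.1 h).trans hρ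
      KPL_row := fun c a => (kPLY_row x b bI hlev hM3 c a).trans (le_of_eq ite_congr_dec)
      KCL_nonneg := fun c a y'' => (hnn c 0 a y'').2.2.2.2.2.2.2.2.1
      KCL_loc := fun c a y'' h => ((hrl c a y'').2.2.2.2.2 h).trans hρ
      KCL_row := fun c a => (kCLY_row x b bI hlev hM3 c a).trans (le_of_eq ite_congr_dec)
      KPt_nonneg := fun c y'' a => (hnn c 0 y'' a).2.2.2.1
      KPt_loc := fun c y'' a h => ((hcl c y'' a).1 h).trans hρ
      KPt_col := fun c a => (kPtY_col x b bI hlev hM3 c a).trans (le_of_eq ite_congr_dec)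
      KCt_nonneg := fun c y'' a => (hnn c 0 y'' a).2.2.2.2.2.2.2.1
      KCt_loc := fun c y'' a h => ((hcl c y'' a).2.1 h).trans hρ
      KCt_col := fun c a => (kCtY_col x b bI hlev hM3 c a).trans (le_of_eq ite_congr_dec)
      KCLt_nonneg := fun c y'' a => (hnn c 0 y'' a).2.2.2.2.2.2.2.2.2.2.1
      KCLt_loc := fun c y'' a h => ((hcl c y'' a).2.2 h).trans hρ
      KCLt_col := fun c a => (kCLtY_col x b bI hlev hM3 c a).trans (le_of_eq ite_congr_dec) }

/-! ## §3 `Sizes.Bounded` at the record -/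

omit [CompleteSpace 𝔸] [DecidableEq κ] [Fintype (geo9Y x).Site] [DecidableEq (geo9Y x).Site] in
/-- ★★ **`hκ` AT THE RECORD**: `(kappaWalkY x b).Bounded K_c θ₀ C_ℓ (geo9Y x).M` for `K_c ≥ KcWalkY`, `θ₀ ≥ thetaWalkY C_ℓ`, `C_ℓ ≥ 0` — print's «for M sufficiently large»
(the `K(h_□)` sizes are `≤ θ₀M⁻¹`, the Leibniz sizes `≤ K_c`) with member-uniform constants. [cite: Balaban1985BackgroundPropagators, (3.89) p.409; Balaban1984PropagatorsII, (2.44) p.230] -/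
theorem bounded_kappaWalkY {Kc θ₀ Cℓ : ℝ} (hCℓ : 0 ≤ Cℓ) (hKc : KcWalkY d ℓ hd hL b₀ b₁ b ≤ Kc) (hθ₀ : thetaWalkY d ℓ hd hL b₀ b₁ b Cℓ ≤ θ₀) :
    (kappaWalkY x b).Bounded Kc θ₀ Cℓ (geo9Y x).M := by
  obtain ⟨_, hMh, _, _⟩ := side_conditions x.toKIdx
  have hM1 : (1 : ℝ) ≤ x.toKIdx.Mh := by exact_mod_cast le_trans (by norm_num) hMh
  have hM : (0 : ℝ) < x.toKIdx.Mh := by linarith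
  have hM2 : (1 : ℝ) ≤ (x.toKIdx.Mh : ℝ) ^ 2 := one_le_pow₀ hM1
  have hcR : 0 ≤ (cR39 b)⁻¹ := inv_nonneg.2 (cR39_nonneg b)
  have hCB := cbY_nonneg b
  have hN3 : (0 : ℝ) ≤ (nbrCountY d ℓ hd hL b₀ b₁ 3 : ℝ) := Nat.cast_nonneg _
  have hL1 : (1 : ℝ) ≤ (((ℓ + 1 : ℕ) : ℝ)) := by exact_mod_cast Nat.succ_le_succ (Nat.zero_le ℓ)
  have hL0 : (0 : ℝ) ≤ (((ℓ + 1 : ℕ) : ℝ)) := Nat.cast_nonneg _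
  have hd1 : (0 : ℝ) ≤ (d : ℝ) + 1 := by positivity
  have hC1 := C1F_nonneg d ℓ
  have hC2 := C2F_nonneg d ℓ
  have hsL := sLipT_nonneg d ℓ
  have hMg : (geo9Y x).M = (((ℓ + 1 : ℕ) : ℝ)) * x.toKIdx.Mh := by rw [geo9Y_M_eq]; push_cast; ring
  -- `X / M_h ≤ X`, `X / M_h² ≤ X`, and the avgLip size `sLipT/(L·M_h) ≤ sLipT`
  have b1 : ∀ {X : ℝ}, 0 ≤ X → X / x.toKIdx.Mh ≤ X := fun hX => div_le_self hX hM1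
  have b2 : ∀ {X : ℝ}, 0 ≤ X → X / (x.toKIdx.Mh : ℝ) ^ 2 ≤ X := fun hX => div_le_self hX hM2
  have hA : avgLipY x ≤ sLipT d ℓ := by
    unfold avgLipY
    exact div_le_self hsL (by push_cast at hL1 ⊢; nlinarith)
  have hA0 := avgLipY_nonneg x
  -- the nine sizes are non-negative
  have n0 : (kappaWalkY x b).Nonneg := by
    refine ⟨?_, ?_, le_rfl, ?_, ?_, ?_, ?_, ?_, ?_⟩ <;> simp only [kappaWalkY] <;> positivity
  -- Leibniz sizes against their `M_h`-free numerators
  have hCD : (kappaWalkY x b).kCD ≤ cbY b * ((d : ℝ) + 1) * (nbrCountY d ℓ hd hL b₀ b₁ 3 : ℝ) * (((ℓ + 1 : ℕ) : ℝ)) ^ 2 * (5 / 8 * C1F d ℓ) := by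
    show cbY b * ((d : ℝ) + 1) * (nbrCountY d ℓ hd hL b₀ b₁ 3 : ℝ) * (((ℓ + 1 : ℕ) : ℝ)) ^ 2 * (5 / 8 * C1F d ℓ / x.toKIdx.Mh) ≤ _
    exact mul_le_mul_of_nonneg_left (b1 (by positivity)) (by positivity)
  have hPL : (kappaWalkY x b).kPL ≤ ((d : ℝ) + 1) * (cbY b * 2 * (nbrCountY d ℓ hd hL b₀ b₁ 3 : ℝ) * (((ℓ + 1 : ℕ) : ℝ)) * (5 / 8 * C1F d ℓ)) := by
    show ((d : ℝ) + 1) * (cbY b * 2 * (nbrCountY d ℓ hd hL b₀ b₁ 3 : ℝ) * (((ℓ + 1 : ℕ) : ℝ)) * (5 / 8 * C1F d ℓ / x.toKIdx.Mh)) ≤ _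
    exact mul_le_mul_of_nonneg_left (mul_le_mul_of_nonneg_left (b1 (by positivity)) (by positivity)) hd1
  have hCL : (kappaWalkY x b).kCL ≤ cbY b * ((d : ℝ) + 1) * (nbrCountY d ℓ hd hL b₀ b₁ 3 : ℝ) * (((ℓ + 1 : ℕ) : ℝ)) ^ 2 * ((5 / 8) ^ 2 * C2F d ℓ) := by
    show cbY b * ((d : ℝ) + 1) * (nbrCountY d ℓ hd hL b₀ b₁ 3 : ℝ) * (((ℓ + 1 : ℕ) : ℝ)) ^ 2 * ((5 / 8) ^ 2 * C2F d ℓ / (x.toKIdx.Mh : ℝ) ^ 2) ≤ _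
    exact mul_le_mul_of_nonneg_left (b2 (by positivity)) (by positivity)
  have hCLt : (kappaWalkY x b).kCLt ≤ cbY b * ((d : ℝ) + 1) * (nbrCountY d ℓ hd hL b₀ b₁ 3 : ℝ) * (5 / 8 * C1F d ℓ) := by
    show cbY b * ((d : ℝ) + 1) * (nbrCountY d ℓ hd hL b₀ b₁ 3 : ℝ) * (5 / 8 * C1F d ℓ / x.toKIdx.Mh) ≤ _
    exact mul_le_mul_of_nonneg_left (b1 (by positivity)) (by positivity)
  have hK : KcWalkY d ℓ hd hL b₀ b₁ b = cbY b * ((d : ℝ) + 1) * (nbrCountY d ℓ hd hL b₀ b₁ 3 : ℝ) * (((ℓ + 1 : ℕ) : ℝ)) ^ 2 * (5 / 8 * C1F d ℓ) +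
      (((d : ℝ) + 1) * (cbY b * 2 * (nbrCountY d ℓ hd hL b₀ b₁ 3 : ℝ) * (((ℓ + 1 : ℕ) : ℝ)) * (5 / 8 * C1F d ℓ)) +
        cbY b * ((d : ℝ) + 1) * (nbrCountY d ℓ hd hL b₀ b₁ 3 : ℝ) * (((ℓ + 1 : ℕ) : ℝ)) ^ 2 * ((5 / 8) ^ 2 * C2F d ℓ)) +
      cbY b * ((d : ℝ) + 1) * (nbrCountY d ℓ hd hL b₀ b₁ 3 : ℝ) * (5 / 8 * C1F d ℓ) := rfl
  -- the `K(h_□)` sizes: `M_h·kP`, `M_h·kC`, `M_h·kPt`, `M_h·kCt` against `M_h`-free numerators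
  have hP : (kappaWalkY x b).kP * x.toKIdx.Mh = ((d : ℝ) + 1) * ((cR39 b)⁻¹ * cbY b * 2 * (nbrCountY d ℓ hd hL b₀ b₁ 3 : ℝ) * (((ℓ + 1 : ℕ) : ℝ)) * (5 / 8 * C1F d ℓ)) := by
    show ((d : ℝ) + 1) * ((cR39 b)⁻¹ * cbY b * 2 * (nbrCountY d ℓ hd hL b₀ b₁ 3 : ℝ) * (((ℓ + 1 : ℕ) : ℝ)) * (5 / 8 * C1F d ℓ / x.toKIdx.Mh)) * x.toKIdx.Mh = _
    field_simp
  have hC : (kappaWalkY x b).kC * x.toKIdx.Mh ≤ (cR39 b)⁻¹ * cbY b * (nbrCountY d ℓ hd hL b₀ b₁ 3 : ℝ) * (((ℓ + 1 : ℕ) : ℝ)) ^ 2 * (((d : ℝ) + 1) * ((5 / 8) ^ 2 * C2F d ℓ) + sLipT d ℓ) := by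
    show (cR39 b)⁻¹ * cbY b * (nbrCountY d ℓ hd hL b₀ b₁ 3 : ℝ) * (((ℓ + 1 : ℕ) : ℝ)) ^ 2 *
        (((d : ℝ) + 1) * ((5 / 8) ^ 2 * C2F d ℓ / (x.toKIdx.Mh : ℝ) ^ 2) + avgLipY x) * x.toKIdx.Mh ≤ _
    have e1 : ((d : ℝ) + 1) * ((5 / 8) ^ 2 * C2F d ℓ / (x.toKIdx.Mh : ℝ) ^ 2) * x.toKIdx.Mh = ((d : ℝ) + 1) * ((5 / 8) ^ 2 * C2F d ℓ) / x.toKIdx.Mh := by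
      field_simp
    have e2 : avgLipY x * x.toKIdx.Mh = sLipT d ℓ / (((ℓ : ℝ) + 1)) := by unfold avgLipY; field_simp
    have i1 : ((d : ℝ) + 1) * ((5 / 8) ^ 2 * C2F d ℓ) / x.toKIdx.Mh ≤ ((d : ℝ) + 1) * ((5 / 8) ^ 2 * C2F d ℓ) := b1 (by positivity)
    have i2 : sLipT d ℓ / (((ℓ : ℝ) + 1)) ≤ sLipT d ℓ := div_le_self hsL (by push_cast at hL1; exact hL1)
    calc (cR39 b)⁻¹ * cbY b * (nbrCountY d ℓ hd hL b₀ b₁ 3 : ℝ) * (((ℓ + 1 : ℕ) : ℝ)) ^ 2 *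
          (((d : ℝ) + 1) * ((5 / 8) ^ 2 * C2F d ℓ / (x.toKIdx.Mh : ℝ) ^ 2) + avgLipY x) * x.toKIdx.Mh
        = (cR39 b)⁻¹ * cbY b * (nbrCountY d ℓ hd hL b₀ b₁ 3 : ℝ) * (((ℓ + 1 : ℕ) : ℝ)) ^ 2 *
          (((d : ℝ) + 1) * ((5 / 8) ^ 2 * C2F d ℓ / (x.toKIdx.Mh : ℝ) ^ 2) * x.toKIdx.Mh + avgLipY x * x.toKIdx.Mh) := by ring
      _ ≤ (cR39 b)⁻¹ * cbY b * (nbrCountY d ℓ hd hL b₀ b₁ 3 : ℝ) * (((ℓ + 1 : ℕ) : ℝ)) ^ 2 * (((d : ℝ) + 1) * ((5 / 8) ^ 2 * C2F d ℓ) + sLipT d ℓ) := by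
          rw [e1, e2]; exact mul_le_mul_of_nonneg_left (add_le_add i1 i2) (by positivity)
  have hPt : (kappaWalkY x b).kPt * x.toKIdx.Mh = ((d : ℝ) + 1) * ((cR39 b)⁻¹ * cbY b * 2 * (nbrCountY d ℓ hd hL b₀ b₁ 3 : ℝ) * (5 / 8 * C1F d ℓ)) := by
    show ((d : ℝ) + 1) * ((cR39 b)⁻¹ * cbY b * 2 * (nbrCountY d ℓ hd hL b₀ b₁ 3 : ℝ) * (5 / 8 * C1F d ℓ / x.toKIdx.Mh)) * x.toKIdx.Mh = _
    field_simp
  have hCt : (kappaWalkY x b).kCt * x.toKIdx.Mh ≤ (cR39 b)⁻¹ * cbY b * (nbrCountY d ℓ hd hL b₀ b₁ 3 : ℝ) * (((d : ℝ) + 1) * ((5 / 8) ^ 2 * C2F d ℓ) + sLipT d ℓ) := by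
    show (cR39 b)⁻¹ * cbY b * (nbrCountY d ℓ hd hL b₀ b₁ 3 : ℝ) * (((d : ℝ) + 1) * ((5 / 8) ^ 2 * C2F d ℓ / (x.toKIdx.Mh : ℝ) ^ 2) + avgLipY x) * x.toKIdx.Mh ≤ _
    have e1 : ((d : ℝ) + 1) * ((5 / 8) ^ 2 * C2F d ℓ / (x.toKIdx.Mh : ℝ) ^ 2) * x.toKIdx.Mh = ((d : ℝ) + 1) * ((5 / 8) ^ 2 * C2F d ℓ) / x.toKIdx.Mh := by
      field_simp
    have e2 : avgLipY x * x.toKIdx.Mh = sLipT d ℓ / (((ℓ : ℝ) + 1)) := by unfold avgLipY; field_simp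
    have i1 : ((d : ℝ) + 1) * ((5 / 8) ^ 2 * C2F d ℓ) / x.toKIdx.Mh ≤ ((d : ℝ) + 1) * ((5 / 8) ^ 2 * C2F d ℓ) := b1 (by positivity)
    have i2 : sLipT d ℓ / (((ℓ : ℝ) + 1)) ≤ sLipT d ℓ := div_le_self hsL (by push_cast at hL1; exact hL1)
    calc (cR39 b)⁻¹ * cbY b * (nbrCountY d ℓ hd hL b₀ b₁ 3 : ℝ) * (((d : ℝ) + 1) * ((5 / 8) ^ 2 * C2F d ℓ / (x.toKIdx.Mh : ℝ) ^ 2) + avgLipY x) * x.toKIdx.Mh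
        = (cR39 b)⁻¹ * cbY b * (nbrCountY d ℓ hd hL b₀ b₁ 3 : ℝ) *
          (((d : ℝ) + 1) * ((5 / 8) ^ 2 * C2F d ℓ / (x.toKIdx.Mh : ℝ) ^ 2) * x.toKIdx.Mh + avgLipY x * x.toKIdx.Mh) := by ring
      _ ≤ (cR39 b)⁻¹ * cbY b * (nbrCountY d ℓ hd hL b₀ b₁ 3 : ℝ) * (((d : ℝ) + 1) * ((5 / 8) ^ 2 * C2F d ℓ) + sLipT d ℓ) := by
          rw [e1, e2]; exact mul_le_mul_of_nonneg_left (add_le_add i1 i2) (by positivity)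
  -- conversion `Y·M_h ≤ T ⟹ Y ≤ (L·T)·M⁻¹` for the row ∕ column clauses
  have conv : ∀ {Y T : ℝ}, Y * x.toKIdx.Mh ≤ T → (((ℓ + 1 : ℕ) : ℝ)) * T ≤ θ₀ → Y ≤ θ₀ * ((geo9Y x).M)⁻¹ := by
    intro Y T h1 h2
    rw [hMg, ← div_eq_mul_inv, le_div_iff₀ (by positivity)]
    calc Y * ((((ℓ + 1 : ℕ) : ℝ)) * x.toKIdx.Mh) = (((ℓ + 1 : ℕ) : ℝ)) * (Y * x.toKIdx.Mh) := by ring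
      _ ≤ (((ℓ + 1 : ℕ) : ℝ)) * T := mul_le_mul_of_nonneg_left h1 hL0
      _ ≤ θ₀ := h2
  refine { nonneg := n0, leibD := ?_, leibL := ?_, leibT := ?_, row := ?_, col := ?_ }
  · have : (kappaWalkY x b).kPD = 0 := rfl
    rw [this, zero_add]; rw [hK] at hKc; linarith [n0.kPL, n0.kCL, n0.kCLt, hPL, hCL, hCLt]
  · rw [hK] at hKc; linarith [n0.kCD, n0.kCLt, hCD, hCLt]
  · rw [hK] at hKc; linarith [n0.kCD, n0.kPL, n0.kCL, hCD, hPL, hCL]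
  · refine conv (T := ((d : ℝ) + 1) * ((cR39 b)⁻¹ * cbY b * 2 * (nbrCountY d ℓ hd hL b₀ b₁ 3 : ℝ) * (((ℓ + 1 : ℕ) : ℝ)) * (5 / 8 * C1F d ℓ)) +
        (cR39 b)⁻¹ * cbY b * (nbrCountY d ℓ hd hL b₀ b₁ 3 : ℝ) * (((ℓ + 1 : ℕ) : ℝ)) ^ 2 * (((d : ℝ) + 1) * ((5 / 8) ^ 2 * C2F d ℓ) + sLipT d ℓ)) ?_ ?_
    · rw [add_mul, hP]; exact add_le_add le_rfl hC
    · exact (le_add_of_nonneg_right (by positivity)).trans hθ₀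
  · refine conv (T := ((d : ℝ) + 1) * ((cR39 b)⁻¹ * cbY b * 2 * (nbrCountY d ℓ hd hL b₀ b₁ 3 : ℝ) * (5 / 8 * C1F d ℓ)) +
        Cℓ * ((cR39 b)⁻¹ * cbY b * (nbrCountY d ℓ hd hL b₀ b₁ 3 : ℝ) * (((d : ℝ) + 1) * ((5 / 8) ^ 2 * C2F d ℓ) + sLipT d ℓ))) ?_ ?_
    · rw [add_mul, hPt]
      have h2 : Cℓ * (kappaWalkY x b).kCt * x.toKIdx.Mh ≤
          Cℓ * ((cR39 b)⁻¹ * cbY b * (nbrCountY d ℓ hd hL b₀ b₁ 3 : ℝ) * (((d : ℝ) + 1) * ((5 / 8) ^ 2 * C2F d ℓ) + sLipT d ℓ)) := by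
        rw [mul_assoc]; exact mul_le_mul_of_nonneg_left hCt hCℓ
      exact add_le_add le_rfl h2
    · exact (le_add_of_nonneg_left (by positivity)).trans hθ₀

/-! ## §4 `Identities₂` at the record -/

omit [CompleteSpace 𝔸] [FiniteDimensional ℝ 𝔸] [DecidableEq κ] [Fintype (geo9Y x).Site] [DecidableEq (geo9Y x).Site] in
/-- ★ **THE REAL CUT-OFF `M_{h_□}` ON THE CARRIER IS THE COORDINATE MODEL OF `cutMulY (h_□)`** (a real scalar commutes with the coordinates; any basis `b`).
[cite: Balaban1985BackgroundPropagators, (3.87) p.409 (h_□), (3.42) p.397 (coordinates), dictionary] -/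
theorem mulOp_hWalkY_eq_mulcoS (c : ↥(cubes x.toKIdx.D.toDomains)) : mulOp (hWalkY (κ := κ) x c) = mulcoS x.toKIdx b (hTY x.toKIdx c) := by
  apply LinearMap.ext; intro f; funext p
  show hTY x.toKIdx c p.1 * f p = coordOpK b (fun _ : Fin (d + 1) => (cutMulY (𝔸 := 𝔸) (hTY x.toKIdx c)).restrictScalars ℝ) f p
  rw [coordOpK_apply, LinearMap.restrictScalars_apply, cutMulY_apply, Complex.coe_smul, map_smul, Finsupp.smul_apply, smul_eq_mul, repr_assembleK]

omit [DecidableEq κ] [DecidableEq (geo9Y x).Site] in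
/-- ★★★ **`Identities₂` AT THE RECORD**: the 21 clauses of `B9Thm37WholeDir.Identities₂` for `opsWalkY ∕ dirOpsWalkY ∕ dirLettersWalkY` at a configuration `U` whose bond
variables and averaging transporters are contraction pairs, under the pins `hβ1 ∕ hlev`, `c_R ≠ 0` and the units of (3.27) (`Δ′_a(U)` and the padded `Δ′_a` of every `□̃(c)`).
[cite: Balaban1985BackgroundPropagators, (3.87)–(3.88) pp.408–409, (3.100) p.413, (3.27) p.395; Balaban1984PropagatorsII, (2.39)–(2.40) pp.229–230, (2.51) p.232] -/
theorem identities₂_opsWalkY (R : ℝ) (H : Prop)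
    (hβ1 : ∀ f : FBondY x.toKIdx, (B6Geom246MultiLevelTorus.geomT x.D).dist (β x.hN x.D x.hk (bI f)) (B6GlobalChartV1.blkV1 x.hN x.D f) ≤ 1)
    (hlev : ∀ f : FBondY x.toKIdx, lvl x.hN x.D x.hk (bI f) = (B6GlobalChartV1.blkV1 x.hN x.D f).1.1)
    (hc : cR39 b ≠ 0) (U : B.Cfg)
    (hU : ∀ (μ : Fin (d + 1)) (w : SiteY x.toKIdx), ‖(UboxY x.toKIdx (cfg U) μ w : 𝔸)‖ ≤ 1 ∧ ‖(((UboxY x.toKIdx (cfg U) μ w)⁻¹ : 𝔸ˣ) : 𝔸)‖ ≤ 1)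
    (hT : ∀ z w : SiteY x.toKIdx, ‖(avgTrY x.toKIdx parS (cfg U) z w : 𝔸)‖ ≤ 1 ∧ ‖(((avgTrY x.toKIdx parS (cfg U) z w)⁻¹ : 𝔸ˣ) : 𝔸)‖ ≤ 1)
    (hΔ : IsUnit (deltaPrimeAY x.toKIdx parS (cfg U))) (hpad : ∀ c : ↥(cubes x.toKIdx.D.toDomains), IsUnit (padDeltaY x.toKIdx parS (cubeDomY x c) (cfg U))) :
    Identities₂ (opsWalkY x b B cfg parS bI) (dirOpsWalkY x b B cfg parS bI) (dirLettersWalkY x b B cfg parS bI) R H U := by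
  have hnn := fun c μ a y'' => kernels_nonneg x b bI c μ a y''
  have hsq : ∀ z : SiteY x.toKIdx, ∑ c : ↥(cubes x.toKIdx.D.toDomains), hTY x.toKIdx c z ^ 2 = 1 := fun z =>
    sum_hT_sq x.toKIdx.D (one_le_Mh_and_P x.toKIdx).1 (one_le_Mh_and_P x.toKIdx).2 z
  have hD : ∀ (c : ↥(cubes x.toKIdx.D.toDomains)) (z : SiteY x.toKIdx), hTY x.toKIdx c z ≠ 0 → z ∈ cubeDomY x c :=
    fun c z h => mem_cubeDomY_of_hTY_ne_zero x c h
  have hm : ∀ c : ↥(cubes x.toKIdx.D.toDomains), mulOp ((opsWalkY x b B cfg parS bI).h c) = mulcoS x.toKIdx b (hTY x.toKIdx c) :=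
    fun c => mulOp_hWalkY_eq_mulcoS x b c
  have hmY : ∀ c : ↥(cubes x.toKIdx.D.toDomains), mulOp ((opsWalkY x b B cfg parS bI).hY c) = mulcoS x.toKIdx b (hTY x.toKIdx c) :=
    fun c => mulOp_hWalkY_eq_mulcoS x b c
  refine
    { hP := fun c μ => hasMajorant_pcoS_kPdY x b B cfg R H hβ1 c μ U (hU μ)
      hPL := fun c μ => hasMajorant_plcoS_kPLdY x b B cfg R H hβ1 c μ U (hU μ)
      hPt := fun c μ => hasMajorant_ptcoS_kPtdY x b B cfg R H hβ1 c μ U (hU μ)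
      KPd_nonneg := fun c μ a y'' => (hnn c μ a y'').1
      KPLd_nonneg := fun c μ a y'' => (hnn c μ a y'').2.2.2.2.1
      KPtd_nonneg := fun c μ a y'' => (hnn c μ a y'').2.2.1
      KPd_sum := fun c a y'' => le_of_eq (sum_kPdY x b bI c a y'')
      KPLd_sum := fun c a y'' => le_of_eq (sum_kPLdY x b bI c a y'')
      KPtd_sum := fun c a y'' => le_of_eq (sum_kPtdY x b bI c a y'')
      hC := fun c => hasMajorant_ccoS_kCY x b B cfg parS R H hβ1 hlev c U hT
      hPD := fun c => hasMajorantHom_zero _ _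
      hCD := fun c => (hasMajorantHom_iff _ _ _).2 (hasMajorant_cdcoS_kCDY x b B cfg R H hβ1 c U hU)
      hCL := fun c => (hasMajorantHom_iff _ _ _).2 (hasMajorant_clcoS_kCLY x b R H hβ1 c)
      hCt := fun c => hasMajorant_ctcoS_kCtY x b B cfg parS R H hβ1 hlev c U hT
      hCLt := fun c => (hasMajorantHom_iff _ _ _).2 (hasMajorant_cltcoS_kCLtY x b B cfg R H hβ1 c U hU)
      leibD := fun c => by rw [hm c, hmY c]; exact leibD_coords x.toKIdx b B cfg U (hTY x.toKIdx c)
      leibT := fun c => by rw [hm c, hmY c]; exact leibT_coords x.toKIdx b B cfg U (hTY x.toKIdx c)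
      inv := inv_coords x.toKIdx b B cfg parS hc U hΔ
      leibL := fun c => by rw [hm c]; exact leibL_coords x.toKIdx b B cfg U (hTY x.toKIdx c)
      eq388 := ?_
      eq388T := ?_ }
  · have h := eq388_coords x.toKIdx b B cfg parS hc U (fun c => hTY x.toKIdx c) hsq (fun c => cubeDomY x c) hD hpad
    simp only [hm]
    exact h
  · have h := eq388T_coords x.toKIdx b B cfg parS hc U (fun c => hTY x.toKIdx c) hsq (fun c => cubeDomY x c) hD hpad
    simp only [hm]
    exact h

end Literature.MathematicalPhysics.QuantumFieldTheory.Balaban1983to89.B9WalkLettersOpsFacts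

end
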